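import Summits.BirchSwinnertonDyer.BirchSwinnertonDyer.Theorems.KolyvaginRoadThreeTowerFormGross
import Summits.BirchSwinnertonDyer.BirchSwinnertonDyer.Theorems.KolyvaginRoadThreeKernelHLSeam
import Literature.NumberTheory.EllipticCurves.HeegnerPointsOfConductorRationalityProofs
import Literature.NumberTheory.EllipticCurves.RingClassGalOverCyclicProofs
import HarnessLib

/-!
# Route `KolyvaginRoadThree` — the TOWER SEAM (G-a) IS PRINT-FREE: Kolyvagin–Heegner data exist at every
# square-free inert level UNCONDITIONALLY; crux ⟹ tower point form with NO named input
# (`--supports stmt-BirchSwinnertonDyer-19574`, helper; cell `bsd-stepL`, seat `bsd-stepL-koly` g15)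

THEOREMS ONLY. The two Gross-1991-§3 binders of `nonempty_kolyvaginHeegnerData_of_grossCM`
(`Theorems/KolyvaginRoadThreeLevelData.lean`, koly p423680) —
h1 = `phi_heegnerPointOfConductor_mem_range_map_ringClassField N W K` (`y(n) = φ(x(n)) ∈ E(K[n])`) and
h2 = `exists_generator_ringClassGalOver K` (`G_ℓ = Gal(K[n]/K[n/ℓ])` cyclic) — are now THEOREMS of the Literature
layer: `phi_heegnerPointOfConductor_mem_range_map_ringClassField_holds` (`HeegnerPointsOfConductorRationalityProofs`,
p494360: Shimura reciprocity at `n² d_K` over `K[n]`) and `exists_generator_ringClassGalOver_holds`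
(`RingClassGalOverCyclicProofs`: the Artin map of `K[n]/K[n/ℓ]` onto `(𝓞_K/ℓ)ˣ/(ℤ/ℓ)ˣ`, cyclic of order `ℓ + 1` at an
inert `ℓ`). This file FEEDS them (reader bsd-cited-r10 gen 6, D-AUDIT-r10-S4-ADDENDUM-1, kernel sheet
`d_audit_r10_S4_add1_check.lean` b85c97e18af4e44d — the reader does not author Summits files; this is the route
owner's landing):

* `grossCM_pointRational`, `grossCM_generator` — the two binder SHAPES of the route (`∀ N W K, …` ∕ `∀ K, …`), closed;
* `nonempty_kolyvaginHeegnerData_printFree` — A1: for `E/ℚ` elliptic, `K : Type` imaginary quadratic Heegner for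
  `N`, every frame `(Dt, β, ι)` with `4N ∣ β² − d_K` and every square-free `n` with inert prime factors,
  `Nonempty (KolyvaginHeegnerData Dt β ι n)` — NO hypothesis beyond these;
* `kolyvaginRoadThree_towerData_printFree` — A2: zhang3-p1's `hKD` shape (hypothesis of
  `KolyCert.towerCertificates_of_zhangSharpFrameAtThree`, p420076; binder `hKDn` of
  `Koly.bsdp_three_onA1_of_kolyvaginFramesHLSeam`) CLOSED;
* `towerCertificates_of_zhangSharpFrameAtThree_printFree` — A3: the deciding decl `ZhangSharpFrameAtThree` ALONE ⟹
  its tower point form (so with the unconditional converse `KolyCert.zhangSharpFrameAtThree_of_towerCertificates`,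
  p418676: crux ⟺ tower point form, UNCONDITIONALLY — the docstrings «modulo the two published facts of Gross 1991
  §3» of `LevelData` ∕ `TowerFormGross` ∕ `KernelHLSeam` are retired by name);
* `towerCertificates_of_zhangSharpFrameAtThreeHL_printFree` — the same for the live HL child
  `ZhangSharpFrameAtThreeHL` (item 19574): at every Hoffstein–Luo A1 frame a witness `(n, d)` of the crux extends to a
  TOWER `d m (m ∣ n)` with `3 ∤ P(n)` in `E(K[n])` — exactly the shape a derived-point certificate delivers
  (koly `KOLY-WITNESS.md`), now with no CM input left as hypothesis;
* `bsdp_three_onA1_of_kolyvaginFramesHLSeam_printFreeSeam` — the closable-in-principle A1 kernel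
  `Koly.bsdp_three_onA1_of_kolyvaginFramesHLSeam` with its binders `hx`, `hσ` (the seam) FED, the other published
  inputs kept as binders (Gross–Zagier, Kolyvagin ×2, Skinner 2016 Thm C, GZK, modularity, newforms, Hoffstein–Luo,
  Mazur's Manin bound, `y₁^τ`-reciprocity, McCallum): the KOLY route needs TWO named facts fewer.
Nothing is asserted about the crux; no class of atom O2@3 moves (PARTITION: O2@3 × A1 — proves-glue; closes: none).
Axioms: the standard trio (the Literature discharges are `#print axioms`-clean, r10 kernel K0∕A1–A3).
References: [GrossLMS1991] §3 (p. 238: `x_n` rational over `K_n`; `G_ℓ` cyclic of order `ℓ+1`), §4 (4.1);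
[Darmon2004] Thm. 3.6; [Cox2013] Thm. 7.24, (7.27); [McCallumLMS1991] Cor. 4.5.
-/

noncomputable section

open scoped Classical

namespace Summit.BirchSwinnertonDyer.BirchSwinnertonDyer.Theorems

open WeierstrassCurve NumberField Literature.NumberTheory.EllipticCurves
  Literature.NumberTheory.EllipticCurves.ModularForms
  Literature.NumberTheory.EllipticCurves.Rank1Residual
  Summit.BirchSwinnertonDyer.Rank1Residual Summit.BirchSwinnertonDyer.Rank1Residual.X11b
  Summit.BirchSwinnertonDyer.Rank1Residual.X11b.Three.Koly

/-! ## §1 The two seam binders, closed -/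

/-- **h1 of the seam, CLOSED at every `(N, W, K)`** (`K : Type`): `y(n) = φ(x(n))` is `K[n]`-rational — the route's
binder shape `∀ N W K, phi_heegnerPointOfConductor_mem_range_map_ringClassField N W K`, from the Literature theorem
`phi_heegnerPointOfConductor_mem_range_map_ringClassField_holds`.
[cite: GrossLMS1991, §3 (p. 238: x_n rational over K_n; y_n = φ(x_n) ∈ E(K_n))] [cite: Darmon2004, Thm. 3.6] -/
theorem grossCM_pointRational :
    ∀ (N : ℕ) [NeZero N] (W : WeierstrassCurve ℚ) (K : Type) [Field K] [NumberField K],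
      phi_heegnerPointOfConductor_mem_range_map_ringClassField N W K :=
  fun N _ W K _ _ ↦ phi_heegnerPointOfConductor_mem_range_map_ringClassField_holds N W K

/-- **h2 of the seam, CLOSED at every `K : Type`**: `G_ℓ = Gal(K[n]/K[n/ℓ])` is cyclic at a square-free level `n`
with `ℓ ∣ n` inert — the route's binder shape `∀ K, exists_generator_ringClassGalOver K`, from the Literature theorem
`exists_generator_ringClassGalOver_holds`. [cite: GrossLMS1991, §3 (p. 238: G_ℓ ≅ (𝓞_K/ℓ)ˣ/(ℤ/ℓ)ˣ cyclic of order ℓ+1)]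
[cite: Cox2013, Thm. 7.24 and (7.27)] -/
theorem grossCM_generator :
    ∀ (K : Type) [Field K] [NumberField K], exists_generator_ringClassGalOver K :=
  fun _ _ _ ↦ exists_generator_ringClassGalOver_holds

/-! ## §2 A1 ∕ A2: the data exist, unconditionally -/

/-- **A1 — Kolyvagin–Heegner data EXIST at every square-free inert level, UNCONDITIONALLY.** For `E/ℚ` elliptic
with model `W`, `K : Type` imaginary quadratic satisfying the Heegner hypothesis for `N`, every modular
parametrisation datum `Dt` at level `N`, every orientation `β` with `4N ∣ β² − d_K`, every embedding `ι : K → ℂ` and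
every square-free `n` all of whose prime factors are inert in `K`: `Nonempty (KolyvaginHeegnerData Dt β ι n)` — koly's
`nonempty_kolyvaginHeegnerData_of_grossCM` with both Gross-§3 inputs fed by the Literature theorems.
[cite: GrossLMS1991, §3 (pp. 238–239) and §4 (4.1)] -/
theorem nonempty_kolyvaginHeegnerData_printFree {K : Type} [Field K] [NumberField K] {N : ℕ} [NeZero N]
    {W : WeierstrassCurve ℚ} [W.IsElliptic]
    (hK : IsImaginaryQuadratic K) (hH : SatisfiesHeegnerHypothesis N K)
    (Dt : ModularParametrizationData W N) (β : ℤ) (ι : K →+* ℂ)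
    (hβ : (4 * N : ℤ) ∣ β ^ 2 - NumberField.discr K) {n : ℕ} (hn : Squarefree n)
    (hinert : ∀ q ∈ n.primeFactors, (Ideal.span {(q : 𝓞 K)}).IsPrime) :
    Nonempty (KolyvaginHeegnerData Dt β ι n) :=
  nonempty_kolyvaginHeegnerData_of_grossCM (grossCM_pointRational N W K) (grossCM_generator K) hK hH Dt β ι hβ hn
    hinert

/-- **A2 — the route's tower-data binder (`hKD` of `KolyCert.towerCertificates_of_zhangSharpFrameAtThree`, `hKDn` of
`Koly.bsdp_three_onA1_of_kolyvaginFramesHLSeam`) CLOSED, no hypotheses at all.**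
[cite: GrossLMS1991, §3 (pp. 238–239)] -/
theorem kolyvaginRoadThree_towerData_printFree :
    ∀ (W : WeierstrassCurve ℚ) [W.IsElliptic] [W.IsGloballyMinimal] [NeZero (W.conductorNorm ℤ)]
      (K : Type) [Field K] [NumberField K]
      (Dt : ModularParametrizationData W (W.conductorNorm ℤ)) (β : ℤ) (ι : K →+* ℂ) (m : ℕ),
      IsImaginaryQuadratic K → SatisfiesHeegnerHypothesis (W.conductorNorm ℤ) K →
      (4 * (W.conductorNorm ℤ : ℤ)) ∣ β ^ 2 - NumberField.discr K → Squarefree m →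
      (∀ q ∈ m.primeFactors, (Ideal.span {(q : 𝓞 K)}).IsPrime) →
      Nonempty (KolyvaginHeegnerData Dt β ι m) :=
  kolyvaginRoadThree_towerData_of_grossCM grossCM_pointRational grossCM_generator

/-! ## §3 A3: crux ⟹ tower point form, unconditionally (parent decl and the live HL child) -/

/-- **A3 — the deciding decl `ZhangSharpFrameAtThree` ALONE implies its tower point form**: zhang3-p1's
`KolyCert.towerCertificates_of_zhangSharpFrameAtThree` (p420076) with `hKD` := `kolyvaginRoadThree_towerData_printFree`.
With the unconditional converse `KolyCert.zhangSharpFrameAtThree_of_towerCertificates` (p418676) the crux is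
EQUIVALENT to «at every Manin-good conductor-1 frame ∃ n ∈ Λ₃ ∃ tower d m (m ∣ n), 3 ∤ P(n) in E(K[n])» with NO
named print input. Nothing is asserted about the crux. [cite: McCallumLMS1991, Cor. 4.5] [cite: GrossLMS1991, §4 (4.1)] -/
theorem towerCertificates_of_zhangSharpFrameAtThree_printFree
    (hZ : Summit.BirchSwinnertonDyer.BirchSwinnertonDyer.Theses.KolyvaginRoadThree.ZhangSharpFrameAtThree) :
    ∀ (W : WeierstrassCurve ℚ) [W.IsElliptic] [W.IsGloballyMinimal] [NeZero (W.conductorNorm ℤ)]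
      (K : Type) [Field K] [NumberField K]
      (Dt : ModularParametrizationData W (W.conductorNorm ℤ)) (β : ℤ) (ι : K →+* ℂ),
      W.HasMultiplicativeReductionAtPrime 3 → Rank1Residual.Surj W 3 → Rank1Residual.Ram W 3 →
      ¬ 3 ∣ W.tamagawaProduct → IsImaginaryQuadratic K →
      SatisfiesHeegnerHypothesis (W.conductorNorm ℤ) K → NumberField.discr K ≠ -3 →
      (4 * (W.conductorNorm ℤ : ℤ)) ∣ β ^ 2 - NumberField.discr K → ¬ (3 : ℤ) ∣ Dt.c →
      ∃ (n : ℕ) (d : (m : ℕ) → m ∣ n → KolyvaginHeegnerData Dt β ι m),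
        KolyvaginDescent.KolSupp (Zhang2014.IsKolyvaginPrime (W.conductorNorm ℤ) W K 3) n ∧
          ¬ PDiv (d n dvd_rfl) 3 1 :=
  towerCertificates_of_zhangSharpFrameAtThree_of_grossCM grossCM_pointRational grossCM_generator hZ

/-- **A3-HL — the live HL crux `ZhangSharpFrameAtThreeHL` (item 19574) ALONE implies its tower point form**: at every
Hoffstein–Luo A1 frame (`ClassX11b W 3`, `d_K` odd, `L(E^{d_K}, 1) ≠ 0` on top of the parent's binders) the crux's
witness `(n, d)` with `c(n) ≢ 0 (mod 3)` extends to a TOWER of Kolyvagin–Heegner data `d m (m ∣ n)` — the lower data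
from A2, unconditionally — whose top carries `3 ∤ P(n)` in `E(K[n])` (`Koly.not_pDiv_of_kolyvaginClass_ne_zero`,
McCallum Cor. 4.5). This is exactly the shape a derived-point certificate delivers (koly `KOLY-WITNESS.md`: `3 ∤ P(2)`
at 8475b1 ∕ 28725a1 ∕ 347253a1 ⊗ ℚ(√−11), …), now with no CM fact left as hypothesis. Nothing is asserted about the
crux. [cite: McCallumLMS1991, Cor. 4.5] [cite: GrossLMS1991, §4 (4.1)] -/
theorem towerCertificates_of_zhangSharpFrameAtThreeHL_printFree
    (hZ : Summit.BirchSwinnertonDyer.BirchSwinnertonDyer.Theses.KolyvaginRoadThree.ZhangSharpFrameAtThreeHL) :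
    ∀ (W : WeierstrassCurve ℚ) [W.IsElliptic] [W.IsGloballyMinimal] [NeZero (W.conductorNorm ℤ)]
      (K : Type) [Field K] [NumberField K]
      (Dt : ModularParametrizationData W (W.conductorNorm ℤ)) (β : ℤ) (ι : K →+* ℂ),
      ClassX11b W 3 → W.HasMultiplicativeReductionAtPrime 3 → Rank1Residual.Surj W 3 → Rank1Residual.Ram W 3 →
      ¬ 3 ∣ W.tamagawaProduct → IsImaginaryQuadratic K → Odd (NumberField.discr K) →
      SatisfiesHeegnerHypothesis (W.conductorNorm ℤ) K →
      (W.quadraticTwist (NumberField.discr K : ℚ)).entireLFunction 1 ≠ 0 → NumberField.discr K ≠ -3 →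
      (4 * (W.conductorNorm ℤ : ℤ)) ∣ β ^ 2 - NumberField.discr K → ¬ (3 : ℤ) ∣ Dt.c →
      ∃ (n : ℕ) (d : (m : ℕ) → m ∣ n → KolyvaginHeegnerData Dt β ι m),
        KolyvaginDescent.KolSupp (Zhang2014.IsKolyvaginPrime (W.conductorNorm ℤ) W K 3) n ∧
          ¬ PDiv (d n dvd_rfl) 3 1 := by
  intro W _ _ _ K _ _ Dt β ι hX hmult hsurj hram htam hK hodd hH hLt h3 hβ hc
  obtain ⟨n, dn, hn, hne⟩ := hZ W K Dt β ι hX hmult hsurj hram htam hK hodd hH hLt h3 hβ hc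
  -- A2 supplies data at every square-free inert level below `n`; the crux's datum sits on top
  have hinert : ∀ m : ℕ, m ∣ n → ∀ q ∈ m.primeFactors, (Ideal.span {(q : 𝓞 K)}).IsPrime :=
    fun m hm q hq ↦ (hn.2 q (Nat.primeFactors_mono hm hn.1.ne_zero hq)).2.2.2.2.1
  let d : (m : ℕ) → m ∣ n → KolyvaginHeegnerData Dt β ι m := fun m hm ↦
    if h : m = n then h ▸ dn
    else Classical.choice
      (kolyvaginRoadThree_towerData_printFree W K Dt β ι m hK hH hβ (hn.1.squarefree_of_dvd hm) (hinert m hm))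
  have hdn : d n dvd_rfl = dn := by
    show (if h : n = n then h ▸ dn else _) = dn
    rw [dif_pos rfl]
  refine ⟨n, d, hn, ?_⟩
  rw [hdn]
  exact not_pDiv_of_kolyvaginClass_ne_zero dn hne

/-! ## §4 The A1 kernel of the route with the seam fed -/

/-- **The closable-in-principle A1 kernel with the tower seam PRINT-FREE**: `Koly.bsdp_three_onA1_of_kolyvaginFramesHLSeam`
(koly, `Theorems/KolyvaginRoadThreeKernelHLSeam.lean`) with `hKDn` := `kolyvaginRoadThree_towerData_printFree` — i.e.
`bsdp_three_onA1_of_kolyvaginFramesHLSeam_of_grossCM` with its two seam binders `hx`, `hσ` FED by the Literature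
theorems. Granted the remaining published inputs (all binders) and the HL+seam crux in hypothesis shape `hZ`:
`BSD(E,3)` for every `E` on atom A1. CONDITIONAL on every binder; nothing booked.
[cite: McCallumLMS1991, §5 Cor. 5.6 (p. 310)] [cite: GrossLMS1991, §3–§4] -/
theorem bsdp_three_onA1_of_kolyvaginFramesHLSeam_printFreeSeam
    (hGZ : ∀ (N : ℕ) [NeZero N] (W : WeierstrassCurve ℚ) (K : Type) [Field K] [NumberField K],
      gross_zagier N W K)
    (hKo : ∀ (N : ℕ) [NeZero N] (W : WeierstrassCurve ℚ) (K : Type) [Field K] [NumberField K],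
      kolyvagin N W K)
    (hB : ∀ (N : ℕ) [NeZero N] (W : WeierstrassCurve ℚ) (K : Type) [Field K] [NumberField K],
      Kolyvagin1990_padicValNat_card_sha_le N W K)
    (hSk : Skinner2016.thmC_padicValRat_bsd_rank_zero)
    (hGZK : rank_eq_analyticRank_of_analyticRank_le_one) (hmod : hasEntireLFunction_rat)
    (hnf : exists_isNewformOf) (hHL : HoffsteinLuo1997_exists_twist_L_one_ne_zero)
    (hMaz : mazur_not_dvd_maninConstant_of_odd)
    (hrec : ∀ (N : ℕ) [NeZero N] (W : WeierstrassCurve ℚ) (K : Type) [Field K] [NumberField K],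
      heegnerPointOfConductor_one_galoisConj N W K)
    (hMc : McCallum1991_pow_dvd_card_sha_primary_of_certificate)
    (hZ : ∀ (W : WeierstrassCurve ℚ) [W.IsElliptic] [W.IsGloballyMinimal] [NeZero (W.conductorNorm ℤ)]
      (K : Type) [Field K] [NumberField K]
      (Dt : ModularParametrizationData W (W.conductorNorm ℤ)) (β : ℤ) (ι : K →+* ℂ),
      ClassX11b W 3 → W.HasMultiplicativeReductionAtPrime 3 → Rank1Residual.Surj W 3 →
      Rank1Residual.Ram W 3 → ¬ 3 ∣ W.tamagawaProduct →
      IsImaginaryQuadratic K → Odd (NumberField.discr K) →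
      SatisfiesHeegnerHypothesis (W.conductorNorm ℤ) K →
      (W.quadraticTwist (NumberField.discr K : ℚ)).entireLFunction 1 ≠ 0 →
      NumberField.discr K ≠ -3 →
      (4 * (W.conductorNorm ℤ : ℤ)) ∣ β ^ 2 - NumberField.discr K → ¬ (3 : ℤ) ∣ Dt.c →
      (∀ m : ℕ, Squarefree m → (∀ q ∈ m.primeFactors, (Ideal.span {(q : 𝓞 K)}).IsPrime) →
        Nonempty (KolyvaginHeegnerData Dt β ι m)) →
      ∃ (n : ℕ) (d : KolyvaginHeegnerData Dt β ι n),
        KolyvaginDescent.KolSupp (Zhang2014.IsKolyvaginPrime (W.conductorNorm ℤ) W K 3) n ∧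
          d.kolyvaginClass Nat.prime_three 1 ≠ 0)
    (W : WeierstrassCurve ℚ) [W.IsElliptic] [W.IsGloballyMinimal]
    (hX : ClassX11b W 3) (hram : Ram W 3) (htam : ¬ 3 ∣ W.tamagawaProduct) : BSDp W 3 :=
  bsdp_three_onA1_of_kolyvaginFramesHLSeam_of_grossCM hGZ hKo hB hSk hGZK hmod hnf hHL hMaz hrec hMc
    grossCM_pointRational grossCM_generator hZ W hX hram htam

/-! ## §5 (appended, koly g15) The conductor-`1` datum — the route's seam conjunct BY NAME -/

/-- **The conductor-`1` Kolyvagin–Heegner datum EXISTS on every admissible frame, UNCONDITIONALLY** — the LAST conjunct of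
the route's support bundle `Theses.KolyvaginRoadThree.PublishedInputsKolyThree` («seam G-a: a conductor-1 Kolyvagin–Heegner
datum EXISTS on every admissible frame … verbatim the hypothesis `hKD` of p410690; to be replaced BY NAME») in its VERBATIM
shape, from A1 at the square-free level `n = 1` (no prime factors, so no inertness condition). Also the hypothesis-free form of
`exists_kolyvaginHeegnerData_one` (`Literature/…/HeegnerPointsOfConductorOneData.lean`, which takes Darmon's Thm 3.6
`phi_heegnerTau_mem_singularModuliField N W K` as a binder). [cite: GrossLMS1991, §3 (p. 238)] [cite: Darmon2004, Thm. 3.6] -/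
theorem nonempty_kolyvaginHeegnerData_one_printFree :
    ∀ (W : WeierstrassCurve ℚ) [W.IsElliptic] [W.IsGloballyMinimal] [NeZero (W.conductorNorm ℤ)]
      (K : Type) [Field K] [NumberField K]
      (Dt : ModularParametrizationData W (W.conductorNorm ℤ)) (β : ℤ) (ι : K →+* ℂ),
      IsImaginaryQuadratic K → SatisfiesHeegnerHypothesis (W.conductorNorm ℤ) K →
      (4 * (W.conductorNorm ℤ : ℤ)) ∣ β ^ 2 - NumberField.discr K →
      Nonempty (KolyvaginHeegnerData Dt β ι 1) :=
  fun W _ _ _ K _ _ Dt β ι hK hH hβ ↦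
    kolyvaginRoadThree_towerData_printFree W K Dt β ι 1 hK hH hβ squarefree_one (by simp)

end Summit.BirchSwinnertonDyer.BirchSwinnertonDyer.Theorems

end
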